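import Summits.AtomisticToContinuum.Crystallization.Theorems.FrustratedLawDichotomyStrainedPatchCoreTubeRecord

/-!
# The far-tail leaf `TailPenalty R μ` of the 27623 junction: DIAL CALCULUS (radius monotonicity, the free endpoint, the lens support,
# the reduction to a weighted far-lens COUNT, the two-radius split)

DEF-FREE structural helper for the crux `AperiodicFrustratedLawGap` (stmt-AtomisticToContinuum-27623), decomp-a2c prover hand 2,
generation 37.  Leaf 6 of the production junction `…AperiodicGapRecordJunctionVerdictFree.aperiodicFrustratedLawGap_of_entryTreesHTA2F_of_coreOff_free`
is `TailPenalty (24/5) (1/1000)` (`…StrainedPatchCleanCollar` §7): on admissible clusters the members' ball average of the FAR pair terms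
`tailOut R` (pairs member × site beyond `R` of the centre, potential `W₄₅`, halved) is `≥ −μ`.  The generic junction
`…VerdictFree.aperiodicFrustratedLawGap_of_verdictTrees_of_coreOff_free` takes the dial `ρ ≥ 17/5` with `TailPenalty ρ μT`, `CoreCoreRelief … ρ ε A`,
`CoreOffTubeFloor … ρ ε φ₁` and the seam `A + μT ≤ m`.  This module records, once and DEF-FREE, the formal facts that make the dial movable:

* §1 the per-pair window bound: `−W₄₅ t ≤ (1/6)·t⁻⁶` for `t ≥ 8/5`, monotone form `−W₄₅ t ≤ (1/6)·R₀⁻⁶` for `8/5 ≤ R₀ ≤ t`;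
* §2 `tailOut`: only far sites INSIDE the range `9/2` of the member count (`tailOut_eq_sum_lens`), the far tail is MONOTONE in the radius
  (`tailOut_mono_radius`, `17/5 ≤ R ≤ R'`), VANISHES from the reach radius `63/10 = 9/5 + 9/2` on (`tailOut_eq_zero_of_reach`), and is bounded by the
  far-lens COUNT times the window bound at the nearest possible distance `R − 9/5` (`neg_tailOut_le_card_mul`); the two-radius difference is the
  ANNULAR sum (`tailOut_sub_eq_sum_annulus`) with the same count bound;
* §3 `TailPenalty`: MONOTONE in the radius (`TailPenalty.of_le_radius`), FREE at the reach (`tailPenalty_of_reach`: `63/10 ≤ R → 0 ≤ μ → TailPenalty R μ`),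
  REDUCED TO A WEIGHTED COUNT (`tailPenalty_of_lensCount`: if on admissible clusters `Σ_{j ∈ B(c,9/5)} #lens_R(j) / #B(j,9/5) ≤ K` then
  `TailPenalty R (K·(R − 9/5)⁻⁶/12)`), and SPLIT at a second radius (`tailPenalty_of_outer_of_annulusCount`:
  `TailPenalty R' μ' ∧ (weighted annular count ≤ K) → TailPenalty R (μ' + K·(R − 9/5)⁻⁶/12)`, `17/5 ≤ R ≤ R'`);
* §4 record literals: `TailPenalty (63/10) 0`; `TailPenalty (24/5) (K/8748)` from a weighted base-lens count `≤ K` (`3⁻⁶/12 = 1/8748`);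
  `TailPenalty (24/5) μ → TailPenalty (26/5) μ → TailPenalty (111/20) μ`; at the reach the core functional is the whole functional
  (`cleanTextureFloor_of_cleanCoreFloor_reach`).

MEASURED (hand-2 g37, pure python `tmp/tail_scan2.py`, homogeneous hosts, potential and cut-offs exactly as in `tailOut`; finding TAILDIAL-hand2-g37.md
on the 27623 evidence list): the base-range leaf is TRUE-LEANING but TIGHT — ideal fcc at nearest-neighbour distance `a = 1`: `−5.16e-4`; relaxed-lattice
region `a = 0.97`: `−7.42e-4`; `a = 0.96⁺` (the 84-site lattice shell `5a` just beyond `24/5`): `−8.54e-4`, i.e. margin `1.5e-4` to `−1/1000`, not `2.9e-4`;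
hcp `a ∈ [0.89, 0.94]`: `−7.3e-4 … −8.1e-4`; every homogeneous fcc/hcp host passing the localised removal test of `Admissible`'s reach (`a ≥ 0.89`)
stays above `−8.6e-4`; the `7/10`-separated, clean but removal-UNSTABLE host fcc `a = 4/5` gives `−1.27e-3 < −1/1000` — so NO proof of leaf 6 from
separation + cleanliness alone exists (any proof must use the equilibrium clause of `¬ExemptNear`), and the count reduction of §3 is the honest
formal residue.  Radius table (fcc `a = 1` / fcc `0.96⁺` / hcp `a = 1`; a lattice shell sitting exactly ON a cut is quoted excluded|included):
`R = 5`: `−2.6e-4|−4.8e-4 / −2.0e-4 / −2.3e-4|−3.1e-4`; `26/5`: `−9.2e-5 / −9.4e-5 / −1.1e-4`; `27/5`: `−3.4e-5 / −4.3e-5 / −5.9e-5`;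
`111/20`: `−3.4e-5 / −1.9e-5 / −2.7e-5`; `29/5`: `≈ −4e-6`; `63/10`: `0` (§4, proved); weighted far-lens counts of §3 at `24/5`: `87 / 107 / 75`.

All statements are elementary bookkeeping over tree definitions (no `def`, no `sorry`, standard axioms); tags: DIAL CALCULUS · PROVED ·
helper · `--supports stmt-AtomisticToContinuum-27623`.  [folklore]
-/

namespace Summit.AtomisticToContinuum.Crystallization.Theorems.FrustratedLawDichotomyStrainedPatchTailDial

open scoped BigOperators Classical
open Literature.MathematicalPhysics.StatisticalMechanics (lennardJones lennardJones_nonpos)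
open Summit.AtomisticToContinuum.Crystallization.Theorems.FrustratedLawDichotomyRangeCut
open Summit.AtomisticToContinuum.Crystallization.Theorems.FrustratedLawDichotomySchurCut
open Summit.AtomisticToContinuum.Crystallization.Theorems.FrustratedLawDichotomyAveragingCut
open Summit.AtomisticToContinuum.Crystallization.Theorems.FrustratedLawDichotomyStrainedPatchHomSplit
open Summit.AtomisticToContinuum.Crystallization.Theorems.FrustratedLawDichotomyStrainedPatchCleanCollar
open Summit.AtomisticToContinuum.Crystallization.Theorems.FrustratedLawDichotomyStrainedPatchCoreTubeRecord

/-! ## §1. The per-pair window bound -/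

/-- `V(t) ≥ −(1/6)·t⁻⁶` for every `t` (`V = (1/12)u² − (1/6)u` with `u = t⁻⁶ ≥ 0`); `private` twin of the tree's
`…OverbindingBudgetEnergyLayerTail.lennardJones_ge_neg` (dedup.landed; that module belongs to another route's import cone). [folklore] -/
private theorem neg_sixth_le_lennardJones (t : ℝ) : -(1 / 6 * (t⁻¹) ^ 6) ≤ lennardJones t := by
  unfold lennardJones
  have h : 0 ≤ (t⁻¹) ^ 12 := by positivity
  nlinarith [h]

/-- **Per-pair window bound**: `−W₄₅ t ≤ (1/6)·t⁻⁶` for `t ≥ 8/5` (`W₄₅ = V·(1 − w₄₅)` there, `V ≤ 0`, `0 ≤ 1 − w₄₅ ≤ 1`). [folklore] -/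
theorem neg_effPot45_le {t : ℝ} (ht : 8 / 5 ≤ t) : -effPot w₄₅ ω₄ (3 / 400) t ≤ 1 / 6 * (t⁻¹) ^ 6 := by
  have hω : ω₄ t = 0 := omega₂_of_two_le (by linarith)
  have hV : lennardJones t ≤ 0 := lennardJones_nonpos (by linarith)
  have hV' := neg_sixth_le_lennardJones t
  have hw0 : 0 ≤ 1 - w₄₅ t := by linarith [(w₄₅_mem t).2]
  have hw1 : 1 - w₄₅ t ≤ 1 := by linarith [(w₄₅_mem t).1]
  simp only [effPot, corePot, hω, mul_zero, sub_zero]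
  nlinarith [mul_le_mul_of_nonpos_left hw1 hV]

/-- Monotone form of the window bound: `−W₄₅ t ≤ (1/6)·R₀⁻⁶` for `8/5 ≤ R₀ ≤ t`. [folklore] -/
theorem neg_effPot45_le_of_le {R₀ t : ℝ} (h₀ : 8 / 5 ≤ R₀) (ht : R₀ ≤ t) : -effPot w₄₅ ω₄ (3 / 400) t ≤ 1 / 6 * (R₀⁻¹) ^ 6 := by
  have h1 := neg_effPot45_le (h₀.trans ht)
  have hR₀ : 0 < R₀ := by linarith
  have ht0 : 0 < t := by linarith
  have h2 : t⁻¹ ≤ R₀⁻¹ := by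
    rw [inv_le_inv₀ ht0 hR₀]; exact ht
  have h3 : (t⁻¹) ^ 6 ≤ (R₀⁻¹) ^ 6 := pow_le_pow_left₀ (inv_nonneg.2 ht0.le) h2 6
  linarith

/-! ## §2. `tailOut`: lens support, radius monotonicity, vanishing at the reach, count bound, annulus -/

/-- A far partner of a member inside the range is at distance `> R − 9/5` from it. [formal bookkeeping] -/
theorem sub_lt_dist_of_far {R : ℝ} {M : ℕ} (z : Fin M → E3) {c j k : Fin M} (hj : dist (z j) (z c) ≤ 9 / 5) (hk : R < dist (z k) (z c)) :
    R - 9 / 5 < dist (z j) (z k) := by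
  have htri := dist_triangle (z k) (z j) (z c)
  rw [dist_comm (z k) (z j)] at htri
  linarith

/-- **LENS SUPPORT**: only the far sites INSIDE the range `9/2` of the member contribute to its far tail (`W₄₅ = 0` from `9/2` on). [folklore] -/
theorem tailOut_eq_sum_lens (R : ℝ) {M : ℕ} (z : Fin M → E3) (c j : Fin M) :
    tailOut R M z c j =
      (∑ k ∈ Finset.univ.filter (fun k => R < dist (z k) (z c) ∧ dist (z j) (z k) < 9 / 2), effPot w₄₅ ω₄ (3 / 400) (dist (z j) (z k))) / 2 := by
  unfold tailOut
  congr 1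
  rw [Finset.sum_filter]
  refine Finset.sum_congr rfl fun k _ => ?_
  by_cases h1 : R < dist (z k) (z c)
  · by_cases h2 : dist (z j) (z k) < 9 / 2
    · simp [h1, h2]
    · have h0 : effPot w₄₅ ω₄ (3 / 400) (dist (z j) (z k)) = 0 := effPot_fourHalf_eq_zero _ (not_lt.1 h2)
      simp [h1, h2, h0]
  · simp [h1]

/-- **RADIUS MONOTONICITY of the far tail** (`17/5 ≤ R ≤ R'`, member `j`): enlarging the radius drops nonpositive terms. [folklore] -/
theorem tailOut_mono_radius {R R' : ℝ} (hR : 17 / 5 ≤ R) (hRR' : R ≤ R') {M : ℕ} (z : Fin M → E3) (c j : Fin M)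
    (hj : dist (z j) (z c) ≤ 9 / 5) : tailOut R M z c j ≤ tailOut R' M z c j := by
  unfold tailOut
  refine div_le_div_of_nonneg_right (Finset.sum_le_sum fun k _ => ?_) (by norm_num)
  by_cases h' : R' < dist (z k) (z c)
  · have h : R < dist (z k) (z c) := lt_of_le_of_lt hRR' h'
    simp [h, h']
  · by_cases h : R < dist (z k) (z c)
    · have hle : effPot w₄₅ ω₄ (3 / 400) (dist (z j) (z k)) ≤ 0 :=
        effPot45_nonpos (by linarith [sub_lt_dist_of_far z hj h])
      simp [h, h', hle]
    · simp [h, h']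

/-- **THE FAR TAIL VANISHES FROM THE REACH RADIUS ON** (`63/10 = 9/5 + 9/2 ≤ R`, member `j`): every far partner is beyond the range. [folklore] -/
theorem tailOut_eq_zero_of_reach {R : ℝ} (hR : 63 / 10 ≤ R) {M : ℕ} (z : Fin M → E3) (c j : Fin M) (hj : dist (z j) (z c) ≤ 9 / 5) :
    tailOut R M z c j = 0 := by
  unfold tailOut
  rw [Finset.sum_eq_zero fun k _ => ?_, zero_div]
  by_cases h : R < dist (z k) (z c)
  · have h0 : effPot w₄₅ ω₄ (3 / 400) (dist (z j) (z k)) = 0 :=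
      effPot_fourHalf_eq_zero _ (by linarith [sub_lt_dist_of_far z hj h])
    simp [h, h0]
  · simp [h]

/-- **COUNT BOUND**: `−tailOut R ≤ #lens_R(j) · (R − 9/5)⁻⁶/12` for a member `j` (`R ≥ 17/5`): each far partner inside the range is at distance
`≥ R − 9/5 ≥ 8/5`, where `−W₄₅ ≤ (1/6)(R − 9/5)⁻⁶`, and the pair term is halved. [folklore] -/
theorem neg_tailOut_le_card_mul {R : ℝ} (hR : 17 / 5 ≤ R) {M : ℕ} (z : Fin M → E3) (c j : Fin M) (hj : dist (z j) (z c) ≤ 9 / 5) :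
    -tailOut R M z c j ≤
      ((Finset.univ.filter (fun k => R < dist (z k) (z c) ∧ dist (z j) (z k) < 9 / 2)).card : ℝ) * (1 / 12 * ((R - 9 / 5)⁻¹) ^ 6) := by
  rw [tailOut_eq_sum_lens]
  have hb : ∀ k ∈ Finset.univ.filter (fun k => R < dist (z k) (z c) ∧ dist (z j) (z k) < 9 / 2),
      -effPot w₄₅ ω₄ (3 / 400) (dist (z j) (z k)) ≤ 1 / 6 * ((R - 9 / 5)⁻¹) ^ 6 := by
    intro k hk
    rw [Finset.mem_filter] at hk
    exact neg_effPot45_le_of_le (by linarith) (sub_lt_dist_of_far z hj hk.2.1).le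
  have hs := Finset.sum_le_sum hb
  rw [Finset.sum_const, nsmul_eq_mul, Finset.sum_neg_distrib] at hs
  linarith

/-- **TWO-RADIUS DIFFERENCE = ANNULAR SUM** (`R ≤ R'`): `tailOut R − tailOut R'` is half the `W₄₅`-interaction of the member with the sites in the
annulus `R < dist ≤ R'` about the centre. [formal bookkeeping] -/
theorem tailOut_sub_eq_sum_annulus {R R' : ℝ} (hRR' : R ≤ R') {M : ℕ} (z : Fin M → E3) (c j : Fin M) :
    tailOut R M z c j - tailOut R' M z c j =
      (∑ k ∈ Finset.univ.filter (fun k => R < dist (z k) (z c) ∧ dist (z k) (z c) ≤ R'), effPot w₄₅ ω₄ (3 / 400) (dist (z j) (z k))) / 2 := by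
  unfold tailOut
  rw [← sub_div, ← Finset.sum_sub_distrib, Finset.sum_filter]
  congr 1
  refine Finset.sum_congr rfl fun k _ => ?_
  by_cases h' : R' < dist (z k) (z c)
  · have h : R < dist (z k) (z c) := lt_of_le_of_lt hRR' h'
    simp [h, h', not_le.2 h']
  · by_cases h : R < dist (z k) (z c)
    · simp [h, h', not_lt.1 h']
    · simp [h, h']

/-- **ANNULAR COUNT BOUND** (`17/5 ≤ R ≤ R'`, member `j`): `tailOut R' − tailOut R ≤ #annulus(R,R'] · (R − 9/5)⁻⁶/12`. [folklore] -/
theorem tailOut_sub_le_card_annulus_mul {R R' : ℝ} (hR : 17 / 5 ≤ R) (hRR' : R ≤ R') {M : ℕ} (z : Fin M → E3) (c j : Fin M)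
    (hj : dist (z j) (z c) ≤ 9 / 5) :
    tailOut R' M z c j - tailOut R M z c j ≤
      ((Finset.univ.filter (fun k => R < dist (z k) (z c) ∧ dist (z k) (z c) ≤ R')).card : ℝ) * (1 / 12 * ((R - 9 / 5)⁻¹) ^ 6) := by
  have h1 := tailOut_sub_eq_sum_annulus hRR' z c j
  have hb : ∀ k ∈ Finset.univ.filter (fun k => R < dist (z k) (z c) ∧ dist (z k) (z c) ≤ R'),
      -effPot w₄₅ ω₄ (3 / 400) (dist (z j) (z k)) ≤ 1 / 6 * ((R - 9 / 5)⁻¹) ^ 6 := by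
    intro k hk
    rw [Finset.mem_filter] at hk
    exact neg_effPot45_le_of_le (by linarith) (sub_lt_dist_of_far z hj hk.2.1).le
  have hs := Finset.sum_le_sum hb
  rw [Finset.sum_const, nsmul_eq_mul, Finset.sum_neg_distrib] at hs
  have hs' := div_le_div_of_nonneg_right hs (by norm_num : (0 : ℝ) ≤ 2)
  rw [neg_div] at hs'
  linarith

/-! ## §3. `TailPenalty`: radius monotonicity, the free endpoint, the count reduction, the two-radius split -/

/-- ★ **`TailPenalty` IS MONOTONE IN THE RADIUS** (`17/5 ≤ R ≤ R'`): a tail budget at radius `R` serves every larger radius. [folklore] -/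
theorem TailPenalty.of_le_radius {R R' μ : ℝ} (hR : 17 / 5 ≤ R) (hRR' : R ≤ R') (hT : TailPenalty R μ) : TailPenalty R' μ := by
  intro M z c hz
  refine (hT M z c hz).trans ?_
  unfold ballAvg
  exact Finset.sum_le_sum fun j hj =>
    div_le_div_of_nonneg_right (tailOut_mono_radius hR hRR' z c j (mem_ball.1 hj)) (Nat.cast_nonneg _)

/-- ★ **THE LEAF IS FREE AT THE REACH RADIUS**: `63/10 ≤ R → 0 ≤ μ → TailPenalty R μ` (on EVERY cluster the far tail of every member is `0`). [folklore] -/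
theorem tailPenalty_of_reach {R μ : ℝ} (hR : 63 / 10 ≤ R) (hμ : 0 ≤ μ) : TailPenalty R μ := by
  intro M z c _
  have h0 : ballAvg (9 / 5) z (tailOut R M z c) c = 0 := by
    unfold ballAvg
    exact Finset.sum_eq_zero fun j hj => by rw [tailOut_eq_zero_of_reach hR z c j (mem_ball.1 hj), zero_div]
  rw [h0]
  linarith

/-- ★ **REDUCTION TO A WEIGHTED FAR-LENS COUNT** (`R ≥ 17/5`): if on every admissible cluster the members' weighted count of far partners inside the
range, `Σ_{j ∈ B(c,9/5)} #{k : R < dist(k,c), dist(j,k) < 9/2} / #B(j,9/5)`, is at most `K`, then `TailPenalty R (K·(R − 9/5)⁻⁶/12)`.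
(A purely combinatorial currency; it forgets the radial profile of `W₄₅` inside the window, so it is lossy at `R = 24/5` and sharp only for
thin lenses.) [folklore] -/
theorem tailPenalty_of_lensCount {R K : ℝ} (hR : 17 / 5 ≤ R)
    (hK : ∀ (M : ℕ) (z : Fin M → E3) (c : Fin M), Admissible M z c →
      ∑ j ∈ ball (9 / 5) z c, ((Finset.univ.filter (fun k => R < dist (z k) (z c) ∧ dist (z j) (z k) < 9 / 2)).card : ℝ) /
        ((ball (9 / 5) z j).card : ℝ) ≤ K) :
    TailPenalty R (K * (1 / 12 * ((R - 9 / 5)⁻¹) ^ 6)) := by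
  intro M z c hz
  have hw : 0 ≤ 1 / 12 * ((R - 9 / 5)⁻¹) ^ 6 := by positivity
  have h1 := hK M z c hz
  unfold ballAvg
  have h2 : ∀ j ∈ ball (9 / 5) z c,
      -(((Finset.univ.filter (fun k => R < dist (z k) (z c) ∧ dist (z j) (z k) < 9 / 2)).card : ℝ) / ((ball (9 / 5) z j).card : ℝ) *
          (1 / 12 * ((R - 9 / 5)⁻¹) ^ 6)) ≤ tailOut R M z c j / ((ball (9 / 5) z j).card : ℝ) := by
    intro j hj
    have h := neg_tailOut_le_card_mul hR z c j (mem_ball.1 hj)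
    have hc : (0 : ℝ) < (ball (9 / 5) z j).card := card_ball_pos (by norm_num) z j
    rw [div_mul_eq_mul_div, ← neg_div]
    exact div_le_div_of_nonneg_right (by linarith) hc.le
  have h3 := Finset.sum_le_sum h2
  rw [Finset.sum_neg_distrib, ← Finset.sum_mul] at h3
  nlinarith [mul_le_mul_of_nonneg_right h1 hw]

/-- ★ **TWO-RADIUS SPLIT** (`17/5 ≤ R ≤ R'`): an outer tail budget `TailPenalty R' μ'` and a weighted count `≤ K` of the sites in the annulus
`R < dist ≤ R'` about the centre give `TailPenalty R (μ' + K·(R − 9/5)⁻⁶/12)`. [folklore] -/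
theorem tailPenalty_of_outer_of_annulusCount {R R' μ' K : ℝ} (hR : 17 / 5 ≤ R) (hRR' : R ≤ R') (hT : TailPenalty R' μ')
    (hK : ∀ (M : ℕ) (z : Fin M → E3) (c : Fin M), Admissible M z c →
      ∑ j ∈ ball (9 / 5) z c, ((Finset.univ.filter (fun k => R < dist (z k) (z c) ∧ dist (z k) (z c) ≤ R')).card : ℝ) /
        ((ball (9 / 5) z j).card : ℝ) ≤ K) :
    TailPenalty R (μ' + K * (1 / 12 * ((R - 9 / 5)⁻¹) ^ 6)) := by
  intro M z c hz
  have hw : 0 ≤ 1 / 12 * ((R - 9 / 5)⁻¹) ^ 6 := by positivity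
  have h0 := hT M z c hz
  have h1 := hK M z c hz
  unfold ballAvg at h0 ⊢
  have h2 : ∀ j ∈ ball (9 / 5) z c,
      tailOut R' M z c j / ((ball (9 / 5) z j).card : ℝ) -
          ((Finset.univ.filter (fun k => R < dist (z k) (z c) ∧ dist (z k) (z c) ≤ R')).card : ℝ) / ((ball (9 / 5) z j).card : ℝ) *
            (1 / 12 * ((R - 9 / 5)⁻¹) ^ 6) ≤ tailOut R M z c j / ((ball (9 / 5) z j).card : ℝ) := by
    intro j hj
    have h := tailOut_sub_le_card_annulus_mul hR hRR' z c j (mem_ball.1 hj)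
    have hc : (0 : ℝ) < (ball (9 / 5) z j).card := card_ball_pos (by norm_num) z j
    rw [div_mul_eq_mul_div, ← sub_div]
    exact div_le_div_of_nonneg_right (by linarith) hc.le
  have h3 := Finset.sum_le_sum h2
  rw [Finset.sum_sub_distrib, ← Finset.sum_mul] at h3
  nlinarith [mul_le_mul_of_nonneg_right h1 hw]

/-! ## §4. Record literals -/

/-- ★ `TailPenalty (63/10) 0` — at the reach radius the leaf holds outright. [folklore instantiation] -/
theorem tailPenalty_reach_zero : TailPenalty (63 / 10) 0 := tailPenalty_of_reach le_rfl le_rfl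

/-- The base-range window constant: `(24/5 − 9/5)⁻⁶/12 = 1/8748`. [formal bookkeeping] -/
theorem base_window_const : (1 : ℝ) / 12 * (((24 : ℝ) / 5 - 9 / 5)⁻¹) ^ 6 = 1 / 8748 := by norm_num

/-- ★ **Base-range count form**: a weighted base-lens count `≤ K` on admissible clusters gives `TailPenalty (24/5) (K/8748)` — so the record leaf
`TailPenalty (24/5) (1/1000)` would follow from `K ≤ 8748/1000`; the measured weighted count of ideal fcc is `≈ 87` (the count currency is `10×` lossy at
the base range, where the window profile of `W₄₅` matters). [folklore instantiation] -/
theorem tailPenalty_base_of_lensCount {K : ℝ}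
    (hK : ∀ (M : ℕ) (z : Fin M → E3) (c : Fin M), Admissible M z c →
      ∑ j ∈ ball (9 / 5) z c, ((Finset.univ.filter (fun k => (24 : ℝ) / 5 < dist (z k) (z c) ∧ dist (z j) (z k) < 9 / 2)).card : ℝ) /
        ((ball (9 / 5) z j).card : ℝ) ≤ K) :
    TailPenalty (24 / 5) (K / 8748) := by
  have h := tailPenalty_of_lensCount (R := 24 / 5) (K := K) (by norm_num) hK
  rw [base_window_const] at h
  have hK' : K / 8748 = K * (1 / 8748) := by ring
  rw [hK']
  exact h

/-- The base-range budget serves the larger dials `26/5` and `111/20` (radius monotonicity). [folklore instantiation] -/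
theorem tailPenalty_dials_of_base {μ : ℝ} (h : TailPenalty (24 / 5) μ) : TailPenalty (26 / 5) μ ∧ TailPenalty (111 / 20) μ :=
  ⟨TailPenalty.of_le_radius (by norm_num) (by norm_num) h, TailPenalty.of_le_radius (by norm_num) (by norm_num) h⟩

/-- ★ At the reach radius the CORE functional is the whole functional: `CleanCoreFloor (63/10) 0 → CleanTextureFloor (63/10)` with NO tail leaf
(`…CleanCollar.cleanTextureFloor_of_coreFloor_of_tailPenalty` at `μ = 0`). [folklore instantiation] -/
theorem cleanTextureFloor_of_cleanCoreFloor_reach (hC : CleanCoreFloor (63 / 10) 0) : CleanTextureFloor (63 / 10) :=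
  cleanTextureFloor_of_coreFloor_of_tailPenalty hC tailPenalty_reach_zero

/-- … and conversely the clean piece at the reach IS the core floor at level `0` there (the tail vanishes member-wise). [folklore] -/
theorem cleanCoreFloor_reach_of_cleanTextureFloor (h : CleanTextureFloor (63 / 10)) : CleanCoreFloor (63 / 10) 0 := by
  have h' := cleanCoreFloor_of_cleanFloor_of_tailUpper (R := 63 / 10) (μ' := 0) h fun M z c _ _ => by
    unfold ballAvg
    exact (Finset.sum_eq_zero fun j hj => by rw [tailOut_eq_zero_of_reach le_rfl z c j (mem_ball.1 hj), zero_div]).le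
  simpa using h'

end Summit.AtomisticToContinuum.Crystallization.Theorems.FrustratedLawDichotomyStrainedPatchTailDial
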